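import Literature.NumberTheory.QuadraticFields.RedeiReichardtGenusValues
import Literature.NumberTheory.QuadraticFields.RedeiReichardtParametrisation
import Literature.NumberTheory.QuadraticFields.RedeiReichardtSymbols
import Mathlib.LinearAlgebra.Matrix.Rank
import HarnessLib

/-!
# The Rédei–Reichardt theorem `r₄(Cl(ℚ(√-n))) = t - 1 - rank RM(D)`: discharge of the named fact

Topic `NumberTheory/QuadraticFields`, namespace `Literature.NumberTheory.QuadraticFields.RedeiReichardt`.
Theorem-only file: it PROVES the Literature named fact `redeiReichardt_fourTwoCard_classGroup`
(`RedeiMatrixFourRank.lean`; Rédei–Reichardt 1934, in the form of Li–Ma, Acta Arith. 134 (2008),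
Thm. 0.4: "Let `r₄` be the `4`-rank of `Cl_K`. Then `r₄ = t − 1 − rank RM(D)`"; Stevenhagen 1995 §2
Thm. 1 with `l = 2`) as `redeiReichardt_fourTwoCard_classGroup_holds`:

  `#(Cl_K² ∩ Cl_K[2]) = 2 ^ (t - 1 - rank RM(D))`  for `K = ℚ(√-n)`, `p₁, …, p_t` the primes of `D`.

Proof (genus theory on ideals, assembled from the `RedeiReichardt*.lean` files of the tree):
the ramified primes `𝔭ᵢ` (`𝔭ᵢ² = (pᵢ)`) parametrise `Cl_K[2]` two-to-one by `e ↦ ∏ [𝔭ᵢ]^{eᵢ}`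
(`exists_parametrisation`), so `2 · #(Cl² ∩ Cl[2]) = #{e ∈ 𝔽₂^t : ∏ [𝔭ᵢ]^{eᵢ} ∈ Cl²}`
(`two_mul_fourTwoCard_eq_natCard`); a class is a square iff all genus characters `ψ_{pᵢ}` (`pᵢ` odd)
vanish on it, and `ψ_{pᵢ}(∏ [𝔭ⱼ]^{eⱼ}) = (-1)^{Σⱼ Mᵢⱼ eⱼ}` with `M = RM(D)ᵀ` (`isSquare_prod_pow_iff`,
`redeiMatrix_transpose_apply`: quadratic reciprocity); the row of `RM(D)ᵀ` at the prime `2` is the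
sum of the others (`redeiMatrix_mulVec_one`), so the condition is `RM(D)ᵀ e = 0`, with
`2^{t - rank RM(D)}` solutions (`card_ker_mulVec_eq`, `rank RM(D)ᵀ = rank RM(D) ≤ t - 1`).

Consumers made unconditional: the `decide`-certificates of `RedeiMatrixFourRank.lean` §4–5 and the
congruent-number files taking the fact as hypothesis `hR` (`Tian2014/ClassFiveFamilyDescentProofs`,
`LiLiuTian2024/CongruentNumberRedeiFamilies`, …).

## References

* L. Rédei, H. Reichardt, J. reine angew. Math. 170 (1934), 69–74. [RedeiReichardt1934]
* Y. Li, L. Ma, Acta Arith. 134 (2008), Lemma 0.1, Def. 0.2, Thm. 0.4. [LiMa2008]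
* P. Stevenhagen, *Rédei-matrices and applications*, LMS LNS 215 (1995), §2 Thm. 1. [Stevenhagen1995RedeiMatrices]
-/

noncomputable section

open NumberField Ideal Module Matrix
open scoped nonZeroDivisors

namespace Literature.NumberTheory.QuadraticFields.RedeiReichardt

open Literature.NumberTheory.QuadraticFields.Quadratic
open Literature.NumberTheory.EllipticCurves.Tian2014 (IsQuadraticFieldOfSqrt fourTwoCard)

variable {t : ℕ} {p : Fin t → ℕ}

/-- **The rows of `RM(D)ᵀ` sum to zero**: `Σᵢ Σⱼ RM(D)ⱼᵢ eⱼ = 0`, since every row of `RM(D)` sums to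
zero (`redeiMatrix_mulVec_one`). Hence the condition at the prime `2` follows from the conditions at
the odd primes. [cite: Stevenhagen1995RedeiMatrices, §2 (after Thm. 1: the column sums of R vanish)] -/
theorem sum_sum_redeiMatrix_mul_eq_zero (n : ℕ) (p : Fin t → ℕ) (e : Fin t → ZMod 2) :
    ∑ i, ∑ j, redeiMatrix n p j i * e j = 0 := by
  rw [Finset.sum_comm]
  refine Finset.sum_eq_zero fun j _ => ?_
  rw [← Finset.sum_mul]
  have h := congr_fun (redeiMatrix_mulVec_one n p) j
  rw [Pi.zero_apply, Matrix.mulVec, dotProduct] at h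
  simp only [mul_one] at h
  rw [h, zero_mul]

/-- If `Σⱼ RM(D)ⱼᵢ eⱼ = 0` for all odd `pᵢ` then for all `i` (the tuple is injective, so at most one
`pᵢ = 2`). [cite: Stevenhagen1995RedeiMatrices, §2] -/
theorem forall_sum_eq_zero_of_odd (hinj : Function.Injective p) (n : ℕ) (e : Fin t → ZMod 2)
    (h : ∀ i, p i ≠ 2 → ∑ j, redeiMatrix n p j i * e j = 0) (i : Fin t) :
    ∑ j, redeiMatrix n p j i * e j = 0 := by
  classical
  by_cases hi : p i = 2
  · have htot := sum_sum_redeiMatrix_mul_eq_zero n p e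
    rw [← Finset.add_sum_erase _ _ (Finset.mem_univ i)] at htot
    have hrest : ∑ k ∈ Finset.univ.erase i, ∑ j, redeiMatrix n p j k * e j = 0 :=
      Finset.sum_eq_zero fun k hk => h k fun hk2 =>
        Finset.ne_of_mem_erase hk (hinj (hk2.trans hi.symm))
    rwa [hrest, add_zero] at htot
  · exact h i hi

/-- **Rédei–Reichardt (1934), in the form of Li–Ma 2008, Thm. 0.4** (discharge of the named fact
`redeiReichardt_fourTwoCard_classGroup`): for `K = ℚ(√-n)` imaginary quadratic with `p₁, …, p_t` the
distinct primes of `disc K`, `#(Cl_K² ∩ Cl_K[2]) = 2^{t − 1 − rank RM(D)}`, i.e. `r₄ = t − 1 − rank RM(D)`.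
[cite: LiMa2008, Thm. 0.4] [cite: RedeiReichardt1934, Satz] [cite: Stevenhagen1995RedeiMatrices, §2 Thm. 1 (l = 2)] -/
theorem redeiReichardt_fourTwoCard_classGroup_holds : redeiReichardt_fourTwoCard_classGroup := by
  intro n t p hp hinj hprod K _ _ hK
  classical
  obtain ⟨h2, x₀, hx₀⟩ := hK
  have hxK : x₀ ^ 2 = -(n : K) := by rw [hx₀]; push_cast; ring
  obtain ⟨x, -, hx⟩ := exists_ringOfIntegers_sq_eq_neg hxK
  have ht : 0 < t := pos_of_prod_eq hprod
  -- the ramified primes and the `2 : 1` parametrisation of `Cl[2]`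
  choose P hP using exists_sq_eq_span hx hp hinj hprod
  obtain ⟨φ, hφ, hker, hrange⟩ := exists_parametrisation h2 hx hp hinj hprod hP
  have hcount := two_mul_fourTwoCard_eq_natCard φ hker hrange
  -- `∏ [𝔭ⱼ]^{eⱼ}` is a square iff `RM(D)ᵀ e = 0`
  have hiff : ∀ e : Fin t → ZMod 2,
      IsSquare (φ (Multiplicative.ofAdd e)) ↔ (redeiMatrix n p)ᵀ *ᵥ e = 0 := by
    intro e
    rw [hφ e, isSquare_prod_pow_iff h2 hx hp hinj hprod hP e]
    have hrow : ∀ i, p i ≠ 2 →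
        (∑ j, (if (if j = i then jacobiSym ((n / p i : ℕ) : ℤ) (p i) else jacobiSym (p j) (p i)) = -1
            then (1 : ZMod 2) else 0) * e j) = ∑ j, redeiMatrix n p j i * e j := fun i hi2 =>
      Finset.sum_congr rfl fun j _ => by rw [redeiMatrix_transpose_apply hp hinj hprod hi2 j]
    constructor
    · intro h
      ext i
      rw [Matrix.mulVec, dotProduct, Pi.zero_apply]
      simp only [Matrix.transpose_apply]
      exact forall_sum_eq_zero_of_odd hinj n e (fun k hk2 => (hrow k hk2) ▸ h k hk2) i
    · intro h i hi2
      rw [hrow i hi2]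
      have := congr_fun h i
      rw [Matrix.mulVec, dotProduct, Pi.zero_apply] at this
      simpa only [Matrix.transpose_apply] using this
  -- count the solutions
  have hcard : Nat.card {v : Multiplicative (Fin t → ZMod 2) // IsSquare (φ v)} =
      Nat.card {e : Fin t → ZMod 2 // (redeiMatrix n p)ᵀ *ᵥ e = 0} :=
    Nat.card_congr (Equiv.subtypeEquiv Multiplicative.toAdd fun v => hiff (Multiplicative.toAdd v))
  rw [hcard, Nat.card_eq_fintype_card, card_ker_mulVec_eq, Matrix.rank_transpose] at hcount
  -- `2 · 2^{r₄} = 2^{t − rank}` with `rank ≤ t − 1`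
  have hrank := rank_redeiMatrix_le n p ht
  have hpow : 2 ^ (t - (redeiMatrix n p).rank) = 2 * 2 ^ (t - 1 - (redeiMatrix n p).rank) := by
    rw [← pow_succ']
    congr 1
    omega
  rw [hpow] at hcount
  omega

end Literature.NumberTheory.QuadraticFields.RedeiReichardt

end
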